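import Summits.AtomisticToContinuum.HydrodynamicLimit.Theorems.ImplosionDichotomyHydroLimitInBandOfHeart
import Literature.MathematicalPhysics.KineticTheory.HardSphereDisplacementPathLength
import Literature.MathematicalPhysics.KineticTheory.HardSphereTwoTimePressure
import HarnessLib

/-!
# The weighted suprathermal-coherence input `CoherentSuprathermalContentVanishesW`: pathwise domination
# and the trivial half `η ≥ 1` (support file, stub `stub_coherence`, line `Sketch`, crux stmt-AtomisticToContinuum-16625)

Crux `TwoClocks.TransferEntropyClock` (stmt-AtomisticToContinuum-16625), line `Sketch`, registered stub S5
`stub_coherence : HydroLimitInBandOfHeart.CoherentSuprathermalContentVanishesW` (the statement is the LANDED def of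
`Theorems/ImplosionDichotomyHydroLimitInBandOfHeart.lean` §2, byte-identical with the sibling crux 14680's S6′ and the
requested child (ii) of the dock stmt-16665). The stub itself is conjecture-grade (a decorrelation claim for fast particles under the TRUE pre-shock
hard-sphere law over `τσ²` mean free times, about which no antecedent of the crux speaks; refuted at the collisionless endpoint
`σ = 0` by `HydroLimitInBandNegative.coherentSuprathermalW_false_with_sigma_zero`) and stays OPEN; this file lands the
cheap, kernel-checked structural facts about the statement AS TYPED:

* §1 pointwise: an admissible radial weight (`R = 0` below `K²`, `|R(s′)| ≤ |s′|`) gives `‖R(‖v‖²) v‖ ≤ 1{K<‖v‖}‖v‖³ ≤ ‖v‖³`;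
* §2 on a window `[s, s+w]`: `‖qbar‖ ≤ cubHi ≤ cub` (`norm_windowAvg_weight_smul_le`, `windowAvg_hi_le_cub`), hence the
  coherence summand `1{η·cub < ‖qbar‖} cubHi` VANISHES for `η ≥ 1` (`coherenceSummand_eq_zero_of_one_le`);
* §3 along good hard-sphere orbits the peculiar velocity `v_i(r) − u(x_i(r))` (any continuous `u`) is measurable in time and
  all its powers are interval integrable (energy conservation + compactness of `𝕋³`), so §2 applies `localGibbsLaw`-a.e.;
* §4 consequently the `η ≥ 1` half of `CoherentSuprathermalContentVanishesW` holds OUTRIGHT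
  (`coherentSuprathermalW_one_le`, any `K⋆ > 0`, any window): the content of the input is exactly `0 < η < 1`; and the tested
  quantity is ANTITONE in `η` pathwise, so the input follows from its restriction to `η` below any fixed level
  (`coherentSuprathermalW_iff_below`): it is a statement about `η → 0⁺`.
-/

noncomputable section

open MeasureTheory Filter Set Topology InformationTheory
open scoped ENNReal

namespace Summit.AtomisticToContinuum.HydrodynamicLimit.Theorems.TransferEntropyClockCoherence

open Literature.MathematicalPhysics.KineticTheory Literature.Analysis.FluidPDE Literature.Analysis.FunctionSpaces
open Summit.AtomisticToContinuum.HydrodynamicLimit.Theorems.HydroLimitInBandOfHeart (CoherentSuprathermalContentVanishesW)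

/-! ## §1 Pointwise domination of an admissible radial weight -/

/-- The suprathermal cube `1{K < ‖v‖} ‖v‖³` is nonnegative. [folklore] -/
theorem ite_pow_three_nonneg (K : ℝ) (v : V3) : 0 ≤ (if K < ‖v‖ then ‖v‖ ^ 3 else (0 : ℝ)) := by
  split_ifs <;> positivity

/-- The suprathermal cube is at most the cube: `1{K < ‖v‖} ‖v‖³ ≤ ‖v‖³`. [folklore] -/
theorem ite_pow_three_le (K : ℝ) (v : V3) : (if K < ‖v‖ then ‖v‖ ^ 3 else (0 : ℝ)) ≤ ‖v‖ ^ 3 := by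
  split_ifs
  exacts [le_rfl, by positivity]

/-- **Pointwise domination.** For a radial weight `R` with `R(s′) = 0` for `s′ ≤ K²` and `|R(s′)| ≤ |s′|` (any real `K`):
`‖R(‖v‖²) v‖ ≤ 1{K < ‖v‖} ‖v‖³`. [folklore] -/
theorem norm_weight_smul_le {K : ℝ} {R : ℝ → ℝ} (hR0 : ∀ s', s' ≤ K ^ 2 → R s' = 0)
    (hR : ∀ s', |R s'| ≤ |s'|) (v : V3) :
    ‖R (‖v‖ ^ 2) • v‖ ≤ (if K < ‖v‖ then ‖v‖ ^ 3 else (0 : ℝ)) := by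
  rw [norm_smul, Real.norm_eq_abs]
  split_ifs with h
  · calc |R (‖v‖ ^ 2)| * ‖v‖ ≤ |‖v‖ ^ 2| * ‖v‖ := mul_le_mul_of_nonneg_right (hR _) (norm_nonneg _)
      _ = ‖v‖ ^ 3 := by rw [abs_of_nonneg (sq_nonneg _)]; ring
  · have h2 : ‖v‖ ^ 2 ≤ K ^ 2 := pow_le_pow_left₀ (norm_nonneg _) (not_lt.1 h) 2
    rw [hR0 _ h2, abs_zero, zero_mul]

/-! ## §2 Window averages: `‖qbar‖ ≤ cubHi ≤ cub`, and the coherence summand vanishes for `η ≥ 1` -/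

/-- The suprathermal cube of a measurable signal with integrable cube is interval integrable. [folklore] -/
theorem intervalIntegrable_hi {K s w : ℝ} {W : ℝ → V3} (hWm : Measurable W)
    (hint : IntervalIntegrable (fun r => ‖W r‖ ^ 3) volume s (s + w)) :
    IntervalIntegrable (fun r => if K < ‖W r‖ then ‖W r‖ ^ 3 else (0 : ℝ)) volume s (s + w) := by
  refine hint.mono_fun ?_ (Eventually.of_forall fun r => ?_)
  · exact (Measurable.ite (measurableSet_lt measurable_const hWm.norm) (hWm.norm.pow_const 3)
      measurable_const).aestronglyMeasurable
  · dsimp only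
    rw [Real.norm_eq_abs, Real.norm_eq_abs, abs_of_nonneg (ite_pow_three_nonneg K (W r)),
      abs_of_nonneg (by positivity)]
    exact ite_pow_three_le K (W r)

/-- **`‖∫ R • W‖ ≤ ∫ 1{K<‖W‖}‖W‖³` on a window.** For `w ≥ 0`, a (time-dependent) admissible radial weight
`ρ r` (`= 0` below `K²`, `|ρ r s′| ≤ |s′|`) and a signal `W` whose suprathermal cube is integrable on `[s, s+w]`. [folklore] -/
theorem norm_integral_weight_smul_le {K s w : ℝ} (hw : 0 ≤ w) {ρ : ℝ → ℝ → ℝ}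
    (hρ0 : ∀ r s', s' ≤ K ^ 2 → ρ r s' = 0) (hρ : ∀ r s', |ρ r s'| ≤ |s'|) (W : ℝ → V3)
    (hint : IntervalIntegrable (fun r => if K < ‖W r‖ then ‖W r‖ ^ 3 else (0 : ℝ)) volume s (s + w)) :
    ‖∫ r in s..(s + w), ρ r (‖W r‖ ^ 2) • W r‖ ≤ ∫ r in s..(s + w), (if K < ‖W r‖ then ‖W r‖ ^ 3 else (0 : ℝ)) := by
  have hsw : s ≤ s + w := by linarith
  rw [intervalIntegral.integral_of_le hsw, intervalIntegral.integral_of_le hsw]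
  exact norm_integral_le_of_norm_le hint.1
    (Eventually.of_forall fun r => norm_weight_smul_le (hρ0 r) (hρ r) (W r))

/-- **`‖qbar‖ ≤ cubHi`**: `‖w⁻¹ • ∫ ρ(‖W‖²) • W‖ ≤ w⁻¹ ∫ 1{K<‖W‖}‖W‖³` for `w > 0`. [folklore] -/
theorem norm_windowAvg_weight_smul_le {K s w : ℝ} (hw : 0 < w) {ρ : ℝ → ℝ → ℝ}
    (hρ0 : ∀ r s', s' ≤ K ^ 2 → ρ r s' = 0) (hρ : ∀ r s', |ρ r s'| ≤ |s'|) (W : ℝ → V3)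
    (hint : IntervalIntegrable (fun r => if K < ‖W r‖ then ‖W r‖ ^ 3 else (0 : ℝ)) volume s (s + w)) :
    ‖w⁻¹ • ∫ r in s..(s + w), ρ r (‖W r‖ ^ 2) • W r‖ ≤
      w⁻¹ * ∫ r in s..(s + w), (if K < ‖W r‖ then ‖W r‖ ^ 3 else (0 : ℝ)) := by
  rw [norm_smul, Real.norm_eq_abs, abs_of_pos (inv_pos.2 hw)]
  exact mul_le_mul_of_nonneg_left (norm_integral_weight_smul_le hw.le hρ0 hρ W hint) (inv_pos.2 hw).le

/-- **`∫ 1{K<‖W‖}‖W‖³ ≤ ∫ ‖W‖³`** on a window, for a signal with integrable cube. [folklore] -/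
theorem integral_hi_le_cub {K s w : ℝ} (hw : 0 ≤ w) (W : ℝ → V3)
    (hint : IntervalIntegrable (fun r => ‖W r‖ ^ 3) volume s (s + w)) :
    ∫ r in s..(s + w), (if K < ‖W r‖ then ‖W r‖ ^ 3 else (0 : ℝ)) ≤ ∫ r in s..(s + w), ‖W r‖ ^ 3 := by
  have hsw : s ≤ s + w := by linarith
  rw [intervalIntegral.integral_of_le hsw, intervalIntegral.integral_of_le hsw]
  exact integral_mono_of_nonneg (Eventually.of_forall fun r => ite_pow_three_nonneg K (W r)) hint.1
    (Eventually.of_forall fun r => ite_pow_three_le K (W r))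

/-- **`cubHi ≤ cub`**: `w⁻¹ ∫ 1{K<‖W‖}‖W‖³ ≤ w⁻¹ ∫ ‖W‖³` for `w > 0`. [folklore] -/
theorem windowAvg_hi_le_cub {K s w : ℝ} (hw : 0 < w) (W : ℝ → V3)
    (hint : IntervalIntegrable (fun r => ‖W r‖ ^ 3) volume s (s + w)) :
    w⁻¹ * ∫ r in s..(s + w), (if K < ‖W r‖ then ‖W r‖ ^ 3 else (0 : ℝ)) ≤ w⁻¹ * ∫ r in s..(s + w), ‖W r‖ ^ 3 :=
  mul_le_mul_of_nonneg_left (integral_hi_le_cub hw.le W hint) (inv_pos.2 hw).le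

/-- The cubic content `cub = w⁻¹ ∫ ‖W‖³ ≥ 0` (no integrability needed). [folklore] -/
theorem windowAvg_cub_nonneg {s w : ℝ} (hw : 0 ≤ w) (W : ℝ → V3) :
    0 ≤ w⁻¹ * ∫ r in s..(s + w), ‖W r‖ ^ 3 :=
  mul_nonneg (inv_nonneg.2 hw) (intervalIntegral.integral_nonneg (by linarith) fun r _ => by positivity)

/-- The suprathermal cubic content `cubHi = w⁻¹ ∫ 1{K<‖W‖}‖W‖³ ≥ 0` (no integrability needed). [folklore] -/
theorem windowAvg_hi_nonneg {K s w : ℝ} (hw : 0 ≤ w) (W : ℝ → V3) :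
    0 ≤ w⁻¹ * ∫ r in s..(s + w), (if K < ‖W r‖ then ‖W r‖ ^ 3 else (0 : ℝ)) :=
  mul_nonneg (inv_nonneg.2 hw)
    (intervalIntegral.integral_nonneg (by linarith) fun r _ => ite_pow_three_nonneg K (W r))

/-- **The coherence summand vanishes for `η ≥ 1`.** For a measurable signal with integrable cube on `[s, s+w]`, `w > 0`
and an admissible weight: `‖qbar‖ ≤ cubHi ≤ cub ≤ η cub`, so `1{η cub < ‖qbar‖} cubHi = 0`. [folklore] -/
theorem coherenceSummand_eq_zero_of_one_le {K s w η : ℝ} (hw : 0 < w) (hη : 1 ≤ η)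
    {ρ : ℝ → ℝ → ℝ} (hρ0 : ∀ r s', s' ≤ K ^ 2 → ρ r s' = 0) (hρ : ∀ r s', |ρ r s'| ≤ |s'|) {W : ℝ → V3}
    (hWm : Measurable W) (hint : IntervalIntegrable (fun r => ‖W r‖ ^ 3) volume s (s + w)) :
    (if η * (w⁻¹ * ∫ r in s..(s + w), ‖W r‖ ^ 3) < ‖w⁻¹ • ∫ r in s..(s + w), ρ r (‖W r‖ ^ 2) • W r‖ then
        w⁻¹ * ∫ r in s..(s + w), (if K < ‖W r‖ then ‖W r‖ ^ 3 else (0 : ℝ)) else 0) = 0 := by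
  have h1 : ‖w⁻¹ • ∫ r in s..(s + w), ρ r (‖W r‖ ^ 2) • W r‖ ≤ w⁻¹ * ∫ r in s..(s + w), ‖W r‖ ^ 3 :=
    (norm_windowAvg_weight_smul_le hw hρ0 hρ W (intervalIntegrable_hi hWm hint)).trans
      (windowAvg_hi_le_cub hw W hint)
  have h2 : w⁻¹ * ∫ r in s..(s + w), ‖W r‖ ^ 3 ≤ η * (w⁻¹ * ∫ r in s..(s + w), ‖W r‖ ^ 3) :=
    le_mul_of_one_le_left (windowAvg_cub_nonneg hw.le W) hη
  rw [if_neg (not_lt.2 (h1.trans h2))]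

/-- **The coherence summand is antitone in `η`** (pathwise, no integrability or measurability needed): for
`0 ≤ η′ ≤ η`, `1{η cub < ‖q‖} cubHi ≤ 1{η′ cub < ‖q‖} cubHi`, because `cub, cubHi ≥ 0`. [folklore] -/
theorem coherenceSummand_antitone {K s w η η' : ℝ} (hw : 0 ≤ w) (hη' : η' ≤ η) (W : ℝ → V3) (q : ℝ) :
    (if η * (w⁻¹ * ∫ r in s..(s + w), ‖W r‖ ^ 3) < q then
        w⁻¹ * ∫ r in s..(s + w), (if K < ‖W r‖ then ‖W r‖ ^ 3 else (0 : ℝ)) else 0) ≤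
      (if η' * (w⁻¹ * ∫ r in s..(s + w), ‖W r‖ ^ 3) < q then
        w⁻¹ * ∫ r in s..(s + w), (if K < ‖W r‖ then ‖W r‖ ^ 3 else (0 : ℝ)) else 0) := by
  have hc := windowAvg_cub_nonneg (s := s) hw W
  have hh := windowAvg_hi_nonneg (K := K) (s := s) hw W
  by_cases h : η * (w⁻¹ * ∫ r in s..(s + w), ‖W r‖ ^ 3) < q
  · have h' : η' * (w⁻¹ * ∫ r in s..(s + w), ‖W r‖ ^ 3) < q :=
      (mul_le_mul_of_nonneg_right hη' hc).trans_lt h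
    rw [if_pos h, if_pos h']
  · rw [if_neg h]
    split_ifs
    · exact hh
    · exact le_rfl

/-! ## §3 Along good hard-sphere orbits: the peculiar velocity is measurable in time with integrable powers -/

variable {ε : ℝ} {M : ℕ}

/-- Along a good orbit on `𝕋³`, the peculiar velocity `r ↦ v_i(r) − u(x_i(r))` w.r.t. a continuous velocity field `u` is
Borel measurable in time (velocities are measurable in time, positions continuous). [folklore] -/
theorem measurable_peculiar_orbit (Φ : HardSphereFlow (Torus.geometry (Fin 3)) ε M) {z : Config M (Fin 3) T3}
    (hz : z ∈ Φ.good) {uu : T3 → V3} (hu : Continuous uu) (i : Fin M) :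
    Measurable fun r => (Φ.flow r z i).2 - uu (Φ.flow r z i).1 :=
  (Φ.measurable_vel_orbit hz i).sub (hu.measurable.comp ((Φ.isTrajectory z hz).pos_continuous i).measurable)

/-- Along a good orbit the peculiar speed is bounded: `‖v_i(r) − u(x_i(r))‖ ≤ √(2E(z)) + max ‖u‖` (energy conservation,
compactness of `𝕋³`). [folklore] -/
theorem exists_norm_peculiar_orbit_le (Φ : HardSphereFlow (Torus.geometry (Fin 3)) ε M) {z : Config M (Fin 3) T3}
    (hz : z ∈ Φ.good) {uu : T3 → V3} (hu : Continuous uu) :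
    ∃ C : ℝ, 0 ≤ C ∧ ∀ (i : Fin M) (r : ℝ), ‖(Φ.flow r z i).2 - uu (Φ.flow r z i).1‖ ≤ C := by
  obtain ⟨xM, -, hxM⟩ := isCompact_univ.exists_isMaxOn univ_nonempty hu.norm.continuousOn
  refine ⟨Real.sqrt (2 * configEnergy z) + ‖uu xM‖, by positivity, fun i r => ?_⟩
  exact (norm_sub_le _ _).trans (add_le_add (Φ.norm_vel_flow_le hz r i) ((isMaxOn_iff.mp hxM) _ (mem_univ _)))

/-- **Along a good orbit every power of the peculiar speed is interval integrable on every bounded interval.** [folklore] -/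
theorem intervalIntegrable_norm_peculiar_pow (Φ : HardSphereFlow (Torus.geometry (Fin 3)) ε M)
    {z : Config M (Fin 3) T3} (hz : z ∈ Φ.good) {uu : T3 → V3} (hu : Continuous uu) (i : Fin M) (n : ℕ)
    (a b : ℝ) : IntervalIntegrable (fun r => ‖(Φ.flow r z i).2 - uu (Φ.flow r z i).1‖ ^ n) volume a b := by
  obtain ⟨C, hC0, hC⟩ := exists_norm_peculiar_orbit_le Φ hz hu
  refine (intervalIntegrable_const (c := C ^ n)).mono_fun'
    ((measurable_peculiar_orbit Φ hz hu i).norm.pow_const n).aestronglyMeasurable (ae_of_all _ fun r => ?_)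
  dsimp only
  rw [Real.norm_eq_abs, abs_of_nonneg (by positivity)]
  exact pow_le_pow_left₀ (norm_nonneg _) (hC i r) n

/-- **The coherence functional of `CoherentSuprathermalContentVanishesW` vanishes `P`-a.e. for `η ≥ 1`**, for any law `P`
carried by the good set, any continuous velocity field, any level `K`, any admissible weight, any window `w > 0` and any
normalisation `c`: its `lintegral` is `0`. [folklore] -/
theorem lintegral_coherence_eq_zero_of_one_le (Φ : HardSphereFlow (Torus.geometry (Fin 3)) ε M)
    (P : Measure (Config M (Fin 3) T3)) (hP : ∀ᵐ z ∂P, z ∈ Φ.good) {uu : T3 → V3} (hu : Continuous uu)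
    {K s w η : ℝ} (c : ℝ) (hw : 0 < w) (hη : 1 ≤ η) {Rw : T3 → ℝ → ℝ}
    (hR0 : ∀ x s', s' ≤ K ^ 2 → Rw x s' = 0) (hR : ∀ x s', |Rw x s'| ≤ |s'|) :
    ∫⁻ z, ENNReal.ofReal (c * ∑ i : Fin M,
      (if η * (w⁻¹ * ∫ r in s..(s + w), ‖(Φ.flow r z i).2 - uu (Φ.flow r z i).1‖ ^ 3) <
          ‖w⁻¹ • ∫ r in s..(s + w), Rw (Φ.flow r z i).1 (‖(Φ.flow r z i).2 - uu (Φ.flow r z i).1‖ ^ 2) •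
            ((Φ.flow r z i).2 - uu (Φ.flow r z i).1)‖ then
        w⁻¹ * ∫ r in s..(s + w), (if K < ‖(Φ.flow r z i).2 - uu (Φ.flow r z i).1‖ then
          ‖(Φ.flow r z i).2 - uu (Φ.flow r z i).1‖ ^ 3 else (0 : ℝ)) else 0)) ∂P = 0 := by
  refine (lintegral_congr_ae (g := fun _ => 0) ?_).trans lintegral_zero
  filter_upwards [hP] with z hz
  rw [Finset.sum_eq_zero fun i _ => ?_, mul_zero, ENNReal.ofReal_zero]
  exact coherenceSummand_eq_zero_of_one_le hw hη (ρ := fun r s' => Rw (Φ.flow r z i).1 s')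
    (fun r s' h => hR0 _ s' h) (fun r s' => hR _ s') (measurable_peculiar_orbit Φ hz hu i)
    (intervalIntegrable_norm_peculiar_pow Φ hz hu i 3 s (s + w))

/-! ## §4 `CoherentSuprathermalContentVanishesW`: the half `η ≥ 1` holds outright; reduction to small `η` -/

/-- **THE HALF `η ≥ 1` OF THE COHERENCE INPUT HOLDS OUTRIGHT.** The type below is VERBATIM the landed def
`HydroLimitInBandOfHeart.CoherentSuprathermalContentVanishesW` with the coherence fraction restricted to `1 ≤ η` (instead of
`0 < η`). Proof: `σ₀ = K⋆ = τ₀ = 1`, `N₀ = 0`; for `η ≥ 1` the tested quantity vanishes `localGibbsLaw`-a.e.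
(`lintegral_coherence_eq_zero_of_one_le` on the good set, which carries the law by `ae_mem_good_localGibbsLaw`; `u s` is
continuous for `s ∈ [0, t] ⊂ [0, T)`), for EVERY family of flows and every window. So the content of the input is exactly the
range `0 < η < 1`. [folklore] -/
theorem coherentSuprathermalW_one_le :
    ∀ (a₀ θ₀ : T3 → ℝ) (u₀ : T3 → V3), Continuous a₀ → Continuous θ₀ → Continuous u₀ →
    (∀ x, 0 < a₀ x) → (∀ x, 0 < θ₀ x) →
    ∃ σ₀ : ℝ, 0 < σ₀ ∧ ∀ σ : ℝ, 0 < σ → σ < σ₀ →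
    ∀ (T : ℝ) (ρ θ : ℝ → T3 → ℝ) (u : ℝ → T3 → V3), IsHardSphereEulerSolution σ T ρ u θ →
    ∀ Φ : (N : ℕ) → HardSphereFlow (Torus.geometry (Fin 3)) (hsDiameter σ N) (N + 1),
    TendstoHydroFieldsAt (fun N => localGibbsLaw σ a₀ u₀ θ₀ N (Φ N)) Φ ρ u θ 0 →
    ∀ t ∈ Set.Ico 0 T, ∃ Kstar : ℝ, 0 < Kstar ∧
    ∀ R : ℝ → T3 → ℝ → ℝ, Measurable (fun p : ℝ × T3 × ℝ => R p.1 p.2.1 p.2.2) →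
    (∀ s x s', s' ≤ Kstar ^ 2 → R s x s' = 0) → (∀ s x s', |R s x s'| ≤ |s'|) →
    ∀ η : ℝ, 1 ≤ η → ∀ ε : ℝ, 0 < ε →
    ∃ τ₀ : ℝ, 0 < τ₀ ∧ ∀ τ : ℝ, τ₀ ≤ τ → ∃ N₀ : ℕ, ∀ N : ℕ, N₀ ≤ N → ∀ s ∈ Set.Icc 0 t,
      (let w : ℝ := τ * ((N : ℝ) + 1) ^ (-(1 / 3 : ℝ))
       let P := localGibbsLaw σ a₀ u₀ θ₀ N (Φ N)
       let W := fun (i : Fin (N + 1)) (s r : ℝ) (z : Config (N + 1) (Fin 3) T3) =>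
         ((Φ N).flow r z i).2 - u s ((Φ N).flow r z i).1
       let cub := fun (i : Fin (N + 1)) (s : ℝ) (z : Config (N + 1) (Fin 3) T3) =>
         w⁻¹ * ∫ r in s..(s + w), ‖W i s r z‖ ^ 3
       let cubHi := fun (i : Fin (N + 1)) (s : ℝ) (z : Config (N + 1) (Fin 3) T3) =>
         w⁻¹ * ∫ r in s..(s + w), (if Kstar < ‖W i s r z‖ then ‖W i s r z‖ ^ 3 else 0)
       let qbar := fun (i : Fin (N + 1)) (s : ℝ) (z : Config (N + 1) (Fin 3) T3) =>
         w⁻¹ • ∫ r in s..(s + w), (R s ((Φ N).flow r z i).1 (‖W i s r z‖ ^ 2)) • W i s r z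
       ∫⁻ z, ENNReal.ofReal (((N : ℝ) + 1)⁻¹ * ∑ i : Fin (N + 1),
              (if η * cub i s z < ‖qbar i s z‖ then cubHi i s z else 0)) ∂P ≤ ENNReal.ofReal ε) := by
  intro a₀ θ₀ u₀ _ _ _ _ _
  refine ⟨1, one_pos, ?_⟩
  intro σ _ _ T ρ θ u hE Φ _ t ht
  refine ⟨1, one_pos, ?_⟩
  intro R _ hR0 hR η hη ε _
  refine ⟨1, one_pos, fun τ hτ => ⟨0, fun N _ s hs => ?_⟩⟩
  dsimp only
  have hw : 0 < τ * ((N : ℝ) + 1) ^ (-(1 / 3 : ℝ)) :=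
    mul_pos (one_pos.trans_le hτ) (Real.rpow_pos_of_pos (by positivity) _)
  have hus : Continuous (u s) := (hE.smooth_velocity.isSmooth_slice ⟨hs.1, hs.2.trans_lt ht.2⟩).continuous
  exact (lintegral_coherence_eq_zero_of_one_le (Φ N) _ (ae_mem_good_localGibbsLaw σ a₀ u₀ θ₀ N (Φ N)) hus
    (((N : ℝ) + 1)⁻¹) hw hη (hR0 s) (hR s)).trans_le bot_le

/-- **REDUCTION TO SMALL `η`: `CoherentSuprathermalContentVanishesW` is EQUIVALENT to its restriction to `0 < η < η₁`, for
every `η₁ > 0`** (the right-hand side is VERBATIM the landed def with the extra binder `η < η₁`). The tested quantity is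
antitone in `η` pathwise (`coherenceSummand_antitone`, for every configuration, no measurability needed), so the input at a
level `η ≥ η₁` follows from the input at level `min η (η₁/2)` with the same thresholds: the input is a statement about
`η → 0⁺`. [folklore] -/
theorem coherentSuprathermalW_iff_below {η₁ : ℝ} (hη₁ : 0 < η₁) :
    CoherentSuprathermalContentVanishesW ↔
    ∀ (a₀ θ₀ : T3 → ℝ) (u₀ : T3 → V3), Continuous a₀ → Continuous θ₀ → Continuous u₀ →
    (∀ x, 0 < a₀ x) → (∀ x, 0 < θ₀ x) →
    ∃ σ₀ : ℝ, 0 < σ₀ ∧ ∀ σ : ℝ, 0 < σ → σ < σ₀ →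
    ∀ (T : ℝ) (ρ θ : ℝ → T3 → ℝ) (u : ℝ → T3 → V3), IsHardSphereEulerSolution σ T ρ u θ →
    ∀ Φ : (N : ℕ) → HardSphereFlow (Torus.geometry (Fin 3)) (hsDiameter σ N) (N + 1),
    TendstoHydroFieldsAt (fun N => localGibbsLaw σ a₀ u₀ θ₀ N (Φ N)) Φ ρ u θ 0 →
    ∀ t ∈ Set.Ico 0 T, ∃ Kstar : ℝ, 0 < Kstar ∧
    ∀ R : ℝ → T3 → ℝ → ℝ, Measurable (fun p : ℝ × T3 × ℝ => R p.1 p.2.1 p.2.2) →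
    (∀ s x s', s' ≤ Kstar ^ 2 → R s x s' = 0) → (∀ s x s', |R s x s'| ≤ |s'|) →
    ∀ η : ℝ, 0 < η → η < η₁ → ∀ ε : ℝ, 0 < ε →
    ∃ τ₀ : ℝ, 0 < τ₀ ∧ ∀ τ : ℝ, τ₀ ≤ τ → ∃ N₀ : ℕ, ∀ N : ℕ, N₀ ≤ N → ∀ s ∈ Set.Icc 0 t,
      (let w : ℝ := τ * ((N : ℝ) + 1) ^ (-(1 / 3 : ℝ))
       let P := localGibbsLaw σ a₀ u₀ θ₀ N (Φ N)
       let W := fun (i : Fin (N + 1)) (s r : ℝ) (z : Config (N + 1) (Fin 3) T3) =>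
         ((Φ N).flow r z i).2 - u s ((Φ N).flow r z i).1
       let cub := fun (i : Fin (N + 1)) (s : ℝ) (z : Config (N + 1) (Fin 3) T3) =>
         w⁻¹ * ∫ r in s..(s + w), ‖W i s r z‖ ^ 3
       let cubHi := fun (i : Fin (N + 1)) (s : ℝ) (z : Config (N + 1) (Fin 3) T3) =>
         w⁻¹ * ∫ r in s..(s + w), (if Kstar < ‖W i s r z‖ then ‖W i s r z‖ ^ 3 else 0)
       let qbar := fun (i : Fin (N + 1)) (s : ℝ) (z : Config (N + 1) (Fin 3) T3) =>
         w⁻¹ • ∫ r in s..(s + w), (R s ((Φ N).flow r z i).1 (‖W i s r z‖ ^ 2)) • W i s r z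
       ∫⁻ z, ENNReal.ofReal (((N : ℝ) + 1)⁻¹ * ∑ i : Fin (N + 1),
              (if η * cub i s z < ‖qbar i s z‖ then cubHi i s z else 0)) ∂P ≤ ENNReal.ofReal ε) := by
  constructor
  · -- the restriction is a special case
    intro h a₀ θ₀ u₀ ha hθ hu ha0 hθ0
    obtain ⟨σ₀, hσ₀, H⟩ := h a₀ θ₀ u₀ ha hθ hu ha0 hθ0
    refine ⟨σ₀, hσ₀, ?_⟩
    intro σ hσ hσlt T ρ θ u hE Φ htie t ht
    obtain ⟨K, hK, HK⟩ := H σ hσ hσlt T ρ θ u hE Φ htie t ht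
    exact ⟨K, hK, fun R hRm hR0 hR η hη _ => HK R hRm hR0 hR η hη⟩
  · -- antitonicity in `η`
    intro h a₀ θ₀ u₀ ha hθ hu ha0 hθ0
    obtain ⟨σ₀, hσ₀, H⟩ := h a₀ θ₀ u₀ ha hθ hu ha0 hθ0
    refine ⟨σ₀, hσ₀, ?_⟩
    intro σ hσ hσlt T ρ θ u hE Φ htie t ht
    obtain ⟨K, hK, HK⟩ := H σ hσ hσlt T ρ θ u hE Φ htie t ht
    refine ⟨K, hK, ?_⟩
    intro R hRm hR0 hR η hη ε hε
    obtain ⟨τ₀, hτ₀, Hτ⟩ := HK R hRm hR0 hR (min η (η₁ / 2)) (lt_min hη (half_pos hη₁))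
      ((min_le_right _ _).trans_lt (half_lt_self hη₁)) ε hε
    refine ⟨τ₀, hτ₀, fun τ hτ => ?_⟩
    obtain ⟨N₀, HN⟩ := Hτ τ hτ
    refine ⟨N₀, fun N hN s hs => ?_⟩
    have Hs := HN N hN s hs
    dsimp only at Hs ⊢
    refine le_trans (lintegral_mono fun z => ENNReal.ofReal_le_ofReal ?_) Hs
    refine mul_le_mul_of_nonneg_left (Finset.sum_le_sum fun i _ => ?_) (by positivity)
    exact coherenceSummand_antitone (mul_nonneg (hτ₀.le.trans hτ) (Real.rpow_nonneg (by positivity) _))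
      (min_le_left _ _) _ _

end Summit.AtomisticToContinuum.HydrodynamicLimit.Theorems.TransferEntropyClockCoherence

end
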